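import Literature.MathematicalPhysics.QuantumLattice.InfiniteVolumeTwistProofs
import Literature.MathematicalPhysics.QuantumLattice.InfiniteVolumeFlipProofs
import Literature.MathematicalPhysics.QuantumLattice.InfiniteVolumeStateIneqProofs
import HarnessLib

/-!
# The Lieb–Schultz–Mattis variational estimate for the Heisenberg chain in infinite volume

Trunk **T-QLATTICE**. Proof file behind the named fact
`Literature.MathematicalPhysics.QuantumLattice.no_unique_gapped_groundState_halfOddSpin`
(`InfiniteVolume.lean`): the variational estimate of Tasaki (2022), Lemma 3.1 and Lemma 3.2, for
the chain `Φ = heisenbergInteraction n J` (`Φ {x,x+1} = J 𝐒_x·𝐒_{x+1}`, range `1`) and the diagonal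
twists `U_θ = exp[-i Σ_x θ_x (Ŝᶻ_x + S)]` of `SpinFlipTwist.lean`:

* `localHamiltonian_heisenbergInteraction` — the local Hamiltonian of the chain in a finite region
  `Λ' ⊆ ℤ` is the bond sum `H_{Λ'} = J Σ_{x, x+1 ∈ Λ'} 𝐒_x·𝐒_{x+1}` (with the combinatorial lemma
  `sum_powerset_card_two_sum_sum`);
* `conj_localHamiltonian_twist` — summing the bond identity of `InfiniteVolumeTwistProofs`
  (`Uᴴ ĥ U + U ĥ Uᴴ - 2ĥ = 2(cos Δθ - 1)(SˣSˣ + SʸSʸ)`) over the bonds: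
  `Ũᴴ H Ũ + Ũ H Ũᴴ - 2H = J Σ_{x,x+1 ∈ Λ'} 2(cos(θ_x - θ_{x+1}) - 1)(Sˣ_xSˣ_{x+1} + Sʸ_xSʸ_{x+1})`
  (Tasaki 2022, proof of Lemma 3.1);
* `HasUniqueGroundState.expect_spinBond_pair` — by translation invariance of the unique ground
  state, every bond has the same transverse correlation `c₀ = ω(Sˣ_0Sˣ_1 + Sʸ_0Sʸ_1)`;
* `IsGappedGroundState.gap_mul_le_twist` — **the variational estimate**: for the unique gapped
  ground state `ω` (gap `γ`), a region `Λ`, any `Λ' ⊇ Λ_1` and angles `θ` on `Λ` (extended by `0`),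
  `γ (1 - |ω(U_θ)|²) ≤ |J| |c₀| Σ_{x,x+1 ∈ Λ'} (2 - 2cos(θ_x - θ_{x+1})) ≤ |J| |c₀| #Λ' B`
  whenever every bond phase satisfies `2 - 2cos(θ_x - θ_{x+1}) ≤ B` — the combination of the gap
  inequality `γ(1 - |ω(U)|²) ≤ ω(Uᴴ[H,U])` (Tasaki 2022, eq. (3.11) in the proof of Lemma 3.2),
  Koma's symmetrisation `ω(Uᴴ[H,U]) ≤ ω(Uᴴ[H,U]) + ω(U[H,Uᴴ])` (first display of the proof of
  Lemma 3.1, using the ground-state inequality for `Uᴴ`) and the bond identity.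

No statement of any other file is changed and no definition is introduced.

## References

* H. Tasaki, *The Lieb–Schultz–Mattis theorem. A topological point of view*, in: The Physics
  and Mathematics of Elliott Lieb, vol. 2, EMS Press (2022) 405–446, arXiv:2202.06243 (held),
  §3.1: Lemma 3.1 (the variational estimate `0 ≤ ω(Ûᴴ[Ĥ,Û]) ≤ C/ℓ`) with its proof (the
  symmetrisation and the bond identity), Lemma 3.2 (`|ω(Û)|² ≥ 1 - C/(ℓ ΔE)`) with its proof.
  [Tasaki2022]
* H. Tasaki, *Lieb–Schultz–Mattis theorem with a local twist for general one-dimensional quantum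
  systems*, J. Stat. Phys. 170 (2018) 653–671, arXiv:1708.05186 (held), Lemma 1 and its proof
  (the symmetrisation trick, attributed to Koma). [Tasaki2018]
-/

noncomputable section

open Matrix Complex Finset
open scoped ComplexOrder

namespace Literature.MathematicalPhysics.QuantumLattice

open Literature.Probability.LatticeModels
open Literature.Probability.LatticeModels (Site)

/-! ### The local Hamiltonian of the chain as a bond sum -/

/-- Double counting over two-element subsets: for `g` vanishing on the diagonal,
`Σ_{Y ⊆ s, #Y = 2} Σ_{x,y ∈ Y} g x y = Σ_{x,y ∈ s} g x y` (each ordered pair `x ≠ y` lies in exactly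
one two-element subset, `{x, y}`). [folklore] -/
theorem sum_powerset_card_two_sum_sum {α M : Type*} [DecidableEq α] [AddCommMonoid M]
    (s : Finset α) (g : α → α → M) (hg : ∀ x, g x x = 0) :
    ∑ Y ∈ s.powerset with Y.card = 2, ∑ x ∈ Y, ∑ y ∈ Y, g x y = ∑ x ∈ s, ∑ y ∈ s, g x y := by
  have key : ∀ Y ∈ s.powerset.filter (·.card = 2),
      ∑ x ∈ Y, ∑ y ∈ Y, g x y = ∑ x ∈ s, ∑ y ∈ s, if x ∈ Y ∧ y ∈ Y then g x y else 0 := by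
    intro Y hY
    have hYs : Y ⊆ s := mem_powerset.1 (mem_filter.1 hY).1
    rw [← Finset.sum_subset hYs (f := fun x => ∑ y ∈ s, if x ∈ Y ∧ y ∈ Y then g x y else 0)]
    · refine sum_congr rfl fun x hx => ?_
      rw [← Finset.sum_subset hYs]
      · exact sum_congr rfl fun y hy => by rw [if_pos ⟨hx, hy⟩]
      · intro y _ hy
        rw [if_neg fun h => hy h.2]
    · intro x _ hx
      exact sum_eq_zero fun y _ => by rw [if_neg fun h => hx h.1]
  rw [sum_congr rfl key, sum_comm]
  refine sum_congr rfl fun x hx => ?_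
  rw [sum_comm]
  refine sum_congr rfl fun y hy => ?_
  rw [← sum_filter, sum_const]
  by_cases hxy : x = y
  · subst hxy
    rw [hg, smul_zero]
  · have hfilter : ((s.powerset.filter (·.card = 2)).filter fun Y => x ∈ Y ∧ y ∈ Y) = {{x, y}} := by
      ext Y
      simp only [mem_filter, mem_powerset, mem_singleton]
      constructor
      · rintro ⟨⟨-, hcard⟩, hxY, hyY⟩
        obtain ⟨a, b, -, rfl⟩ := card_eq_two.1 hcard
        simp only [mem_insert, mem_singleton] at hxY hyY
        rcases hxY with rfl | rfl <;> rcases hyY with rfl | rfl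
        · exact absurd rfl hxy
        · rfl
        · exact Finset.pair_comm _ _
        · exact absurd rfl hxy
      · rintro rfl
        refine ⟨⟨fun z hz => ?_, card_pair hxy⟩, mem_insert_self _ _,
          mem_insert_of_mem (mem_singleton_self _)⟩
        simp only [mem_insert, mem_singleton] at hz
        rcases hz with rfl | rfl
        · exact hx
        · exact hy
    rw [hfilter, card_singleton, one_smul]

/-- On `ℤ` no site is its own right neighbour: `x ≠ x + 1`. [folklore] -/
theorem Site.ne_add_one (x : Site 1) : x ≠ x + 1 := fun h =>
  one_ne_zero ((left_eq_add).1 h)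

/-- **The local Hamiltonian of the Heisenberg chain is the bond sum**: for every finite region
`Λ' ⊆ ℤ`, `H_{Λ'} = Σ_{Y ⊆ Λ'} Φ Y = J Σ_{x, y ∈ Λ', y = x+1} 𝐒_x·𝐒_y` (the only nonzero terms of
`heisenbergInteraction n J` are `Φ {x, x+1} = J 𝐒_x·𝐒_{x+1}`). Tasaki (2020) §2.4, eq. (2.4.1) /
Tasaki (2022) eq. (2.2) (`Ĥ_HAF = Σ_j 𝐒_j·𝐒_{j+1}`). [cite: Tasaki2022, §2.1 (Ĥ_HAF)] -/
theorem localHamiltonian_heisenbergInteraction (n : ℕ) (J : ℝ) (Λ' : Finset (Site 1)) :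
    localHamiltonian ((heisenbergInteraction n J).restrict Λ') univ =
      (J : ℂ) • ∑ x : ↥Λ', ∑ y : ↥Λ', if (y : Site 1) = x + 1 then spinDot n x y else 0 := by
  -- the bond term as a function of two sites of `ℤ`, vanishing off `Λ'` and off the bonds
  set g : Site 1 → Site 1 → Op ↥Λ' (n + 1) := fun x y =>
    if hx : x ∈ Λ' then if hy : y ∈ Λ' then
      if y = x + 1 then spinDot n (⟨x, hx⟩ : ↥Λ') ⟨y, hy⟩ else 0 else 0 else 0 with hg
  have hgxx : ∀ x, g x x = 0 := fun x => by
    simp only [hg]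
    by_cases hx : x ∈ Λ'
    · rw [dif_pos hx, dif_pos hx, if_neg (Site.ne_add_one x)]
    · rw [dif_neg hx]
  have hterm : ∀ Y ∈ Λ'.powerset,
      (if hY : Y ⊆ Λ' then embedOp hY (heisenbergInteraction n J Y) else 0) =
        if Y.card = 2 then (J : ℂ) • ∑ x ∈ Y, ∑ y ∈ Y, g x y else 0 := by
    intro Y hY
    have hYs : Y ⊆ Λ' := mem_powerset.1 hY
    rw [dif_pos hYs, heisenbergInteraction_apply]
    split_ifs with h2
    · rw [embedOp_smul, embedOp_sum]
      congr 1
      rw [← Finset.sum_coe_sort Y]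
      refine sum_congr rfl fun x _ => ?_
      rw [embedOp_sum, ← Finset.sum_coe_sort Y]
      refine sum_congr rfl fun y _ => ?_
      simp only [hg, dif_pos (hYs x.2), dif_pos (hYs y.2)]
      split_ifs
      · exact embedOp_spinDot n hYs x y
      · exact embedOp_zero hYs
    · exact embedOp_zero hYs
  rw [localHamiltonian_restrict_eq_sum, sum_congr rfl hterm, ← sum_filter, ← smul_sum,
    sum_powerset_card_two_sum_sum Λ' g hgxx, ← Finset.sum_coe_sort Λ']
  congr 1
  refine sum_congr rfl fun x _ => ?_
  rw [← Finset.sum_coe_sort Λ']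
  refine sum_congr rfl fun y _ => ?_
  simp only [hg, dif_pos x.2, dif_pos y.2]

/-! ### The symmetrised twist of the chain Hamiltonian -/

/-- **Twisting the chain Hamiltonian (both ways).** For the bond sum `H = H_{Λ'}` of the chain and a
diagonal twist `Ũ = U_θ` on `Λ'`,
`Ũᴴ H Ũ + Ũ H Ũᴴ - 2H = J Σ_{x,y ∈ Λ', y=x+1} 2(cos(θ_x - θ_y) - 1)(Sˣ_xSˣ_y + Sʸ_xSʸ_y)` — the bond
identity `conjTranspose_twistOp_conj_spinDot_add` summed over the bonds (Tasaki 2022, proof of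
Lemma 3.1: `[Ûᴴ,[Ĥ,Û]] = Σ_j {Ûᴴĥ_jÛ + Ûĥ_jÛᴴ - 2ĥ_j}` and its evaluation).
[cite: Tasaki2022, §3.1 Lemma 3.1 (proof)] -/
theorem conj_localHamiltonian_twist (n : ℕ) (J : ℝ) (Λ' : Finset (Site 1)) (θ : ↥Λ' → ℝ) :
    (twistOp θ)ᴴ * localHamiltonian ((heisenbergInteraction n J).restrict Λ') univ * twistOp θ +
        twistOp θ * localHamiltonian ((heisenbergInteraction n J).restrict Λ') univ * (twistOp θ)ᴴ -
        2 • localHamiltonian ((heisenbergInteraction n J).restrict Λ') univ =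
      (J : ℂ) • ∑ x : ↥Λ', ∑ y : ↥Λ', if (y : Site 1) = x + 1 then
        ((2 * Real.cos (θ x - θ y) - 2 : ℝ) : ℂ) • (spinBond n 0 x y + spinBond n 1 x y) else 0 := by
  set U : Op ↥Λ' (n + 1) := twistOp θ with hU
  -- the symmetrised conjugation as a linear map
  set K : Op ↥Λ' (n + 1) →ₗ[ℂ] Op ↥Λ' (n + 1) :=
    (LinearMap.mulLeft ℂ Uᴴ).comp (LinearMap.mulRight ℂ U) +
      (LinearMap.mulLeft ℂ U).comp (LinearMap.mulRight ℂ Uᴴ) - 2 • LinearMap.id with hK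
  have hKapply : ∀ M : Op ↥Λ' (n + 1), K M = Uᴴ * M * U + U * M * Uᴴ - 2 • M := fun M => by
    simp only [hK, LinearMap.sub_apply, LinearMap.add_apply, LinearMap.comp_apply,
      LinearMap.mulLeft_apply, LinearMap.mulRight_apply, LinearMap.smul_apply, LinearMap.id_apply,
      mul_assoc]
  rw [← hKapply, localHamiltonian_heisenbergInteraction, map_smul, map_sum]
  congr 1
  refine sum_congr rfl fun x _ => ?_
  rw [map_sum]
  refine sum_congr rfl fun y _ => ?_
  split_ifs with hxy
  · rw [hKapply, hU]
    exact conjTranspose_twistOp_conj_spinDot_add n θ fun h => Site.ne_add_one (x : Site 1)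
      (by rw [← hxy, h])
  · exact map_zero K

/-! ### Translation invariance of the bond correlation -/

/-- **All bonds have the same transverse correlation in the unique ground state.** For the
Heisenberg chain with a unique infinite-volume ground state `ω` and any bond `(x, x+1)` of a region
`Λ'`, `ω_{Λ'}(Sˣ_xSˣ_{x+1} + Sʸ_xSʸ_{x+1}) = ω_{{0,1}}(Sˣ_0Sˣ_1 + Sʸ_0Sʸ_1)` (translation invariance,
`HasUniqueGroundState.expect_shift_heisenberg`, transported through isotony). Tasaki (2022) §3.2,
eq. (3.12) (translation invariance of the state) and the paragraph before Cor. 3.6.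
[cite: Tasaki2022, §3.2 eq. (3.12)] -/
theorem HasUniqueGroundState.expect_spinBond_pair (n : ℕ) {J : ℝ}
    (hU : HasUniqueGroundState (heisenbergInteraction n J) 1) {ω : InfVolState 1 (n + 1)}
    (hω : ω ∈ groundStates (heisenbergInteraction n J) 1) {Λ' : Finset (Site 1)} (x y : ↥Λ')
    (hxy : (y : Site 1) = x + 1) :
    ω.expect Λ' (spinBond n 0 x y + spinBond n 1 x y) =
      ω.expect {0, 1}
        (spinBond n 0 (⟨0, mem_insert_self 0 {1}⟩ : ↥({0, 1} : Finset (Site 1)))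
            ⟨1, mem_insert_of_mem (mem_singleton_self 1)⟩ +
          spinBond n 1 (⟨0, mem_insert_self 0 {1}⟩ : ↥({0, 1} : Finset (Site 1)))
            ⟨1, mem_insert_of_mem (mem_singleton_self 1)⟩) := by
  set P₀ : Finset (Site 1) := {0, 1} with hP₀
  set a₀ : ↥P₀ := ⟨0, mem_insert_self 0 {1}⟩
  set b₀ : ↥P₀ := ⟨1, mem_insert_of_mem (mem_singleton_self 1)⟩
  set v : Site 1 := (x : Site 1) with hv
  have hPx : P₀.map (Site.shift v).toEmbedding ⊆ Λ' := by
    intro z hz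
    simp only [hP₀, Finset.mem_map, mem_insert, mem_singleton, Equiv.coe_toEmbedding,
      Site.shift_apply] at hz
    obtain ⟨w, hw, rfl⟩ := hz
    rcases hw with rfl | rfl
    · rw [zero_add]; exact x.2
    · rw [add_comm, ← hxy]; exact y.2
  set e := finsetMapEquiv (Site.shift v).toEmbedding P₀ with he
  have hea : (⟨(e a₀ : Site 1), hPx (e a₀).2⟩ : ↥Λ') = x :=
    Subtype.ext (by rw [coe_finsetMapEquiv_apply]; exact zero_add v)
  have heb : (⟨(e b₀ : Site 1), hPx (e b₀).2⟩ : ↥Λ') = y :=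
    Subtype.ext (by rw [coe_finsetMapEquiv_apply, hxy]; exact add_comm 1 v)
  have key : spinBond n 0 x y + spinBond n 1 x y =
      embedOp hPx (transportOp e (spinBond n 0 a₀ b₀ + spinBond n 1 a₀ b₀)) := by
    rw [transportOp_add, transportOp_spinBond, transportOp_spinBond, embedOp_add, embedOp_spinBond,
      embedOp_spinBond, hea, heb]
  rw [key, ω.compatible hPx, he, hU.expect_shift_heisenberg n hω v P₀]

/-! ### The variational estimate -/

/-- A double sum over the bonds of `Λ'` with terms bounded by `B ≥ 0` is at most `#Λ' · B` (each
site has at most one right neighbour). [folklore] -/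
theorem sum_sum_ite_succ_le {Λ' : Finset (Site 1)} {g : ↥Λ' → ↥Λ' → ℝ} {B : ℝ} (hB0 : 0 ≤ B)
    (hB : ∀ x y : ↥Λ', (y : Site 1) = x + 1 → g x y ≤ B) :
    (∑ x : ↥Λ', ∑ y : ↥Λ', if (y : Site 1) = x + 1 then g x y else 0) ≤ Λ'.card * B := by
  have hinner : ∀ x : ↥Λ', (∑ y : ↥Λ', if (y : Site 1) = x + 1 then g x y else 0) ≤ B := by
    intro x
    rw [← sum_filter]
    have hcard : (univ.filter fun y : ↥Λ' => (y : Site 1) = x + 1).card ≤ 1 :=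
      card_le_one.2 fun a ha b hb =>
        Subtype.ext ((mem_filter.1 ha).2.trans (mem_filter.1 hb).2.symm)
    calc _ ≤ ∑ y ∈ univ.filter (fun y : ↥Λ' => (y : Site 1) = x + 1), B :=
          sum_le_sum fun y hy => hB x y (mem_filter.1 hy).2
      _ = (univ.filter fun y : ↥Λ' => (y : Site 1) = x + 1).card * B := by
          rw [sum_const, nsmul_eq_mul]
      _ ≤ 1 * B := mul_le_mul_of_nonneg_right (by exact_mod_cast hcard) hB0
      _ = B := one_mul B
  calc _ ≤ ∑ _x : ↥Λ', B := sum_le_sum fun x _ => hinner x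
    _ = Λ'.card * B := by rw [sum_const, nsmul_eq_mul, Finset.card_univ, Fintype.card_coe]

/-- **The Lieb–Schultz–Mattis / Affleck–Lieb variational estimate in infinite volume.** Let `ω` be a
gapped ground state (gap `γ`) of the Heisenberg chain `Φ = heisenbergInteraction n J` which is
moreover its unique ground state, `Λ` a finite region, `Λ' ⊇ Λ_1` and `θ` angles on `Λ` (extended
by `0` to `Λ'`), such that every bond phase satisfies `2 - 2cos(θ_x - θ_{x+1}) ≤ B` (`B ≥ 0`). Then
`γ (1 - |ω(U_θ)|²) ≤ |J| · |c₀| · #Λ' · B`, `c₀ = ω(Sˣ_0Sˣ_1 + Sʸ_0Sʸ_1)`. Proof: the gap inequality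
gives `γ(1 - |ω(U)|²) ≤ ω(ŨᴴHŨ - H)` (Tasaki 2022, eq. (3.11), `gap_mul_le_re_expect_unitary`); the
ground-state inequality for `Uᴴ` gives `0 ≤ ω(ŨHŨᴴ - H)` (Koma's symmetrisation, first display of the
proof of Lemma 3.1); the sum is `ω` of the twisted bond sum `conj_localHamiltonian_twist`, whose
bond correlations all equal `c₀` (`expect_spinBond_pair`). This is Lemma 3.1 with Lemma 3.2 of
Tasaki (2022) for the chain, with the bond phases left free. [cite: Tasaki2022, §3.1 Lemma 3.1 and Lemma 3.2] -/
theorem InfVolState.IsGappedGroundState.gap_mul_le_twist (n : ℕ) {J γ : ℝ}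
    {ω : InfVolState 1 (n + 1)} (hgap : ω.IsGappedGroundState (heisenbergInteraction n J) 1 γ)
    (hU : HasUniqueGroundState (heisenbergInteraction n J) 1) {Λ Λ' : Finset (Site 1)}
    (hT : thicken Λ 1 ⊆ Λ') (θ : ↥Λ → ℝ) {B : ℝ} (hB0 : 0 ≤ B)
    (hB : ∀ x y : ↥Λ', (y : Site 1) = x + 1 →
      2 - 2 * Real.cos ((if hx : (x : Site 1) ∈ Λ then θ ⟨x, hx⟩ else 0) -
        (if hy : (y : Site 1) ∈ Λ then θ ⟨y, hy⟩ else 0)) ≤ B) :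
    γ * (1 - ‖ω.expect Λ (twistOp θ)‖ ^ 2) ≤
      |J| * ‖ω.expect {0, 1}
        (spinBond n 0 (⟨0, mem_insert_self 0 {1}⟩ : ↥({0, 1} : Finset (Site 1)))
            ⟨1, mem_insert_of_mem (mem_singleton_self 1)⟩ +
          spinBond n 1 (⟨0, mem_insert_self 0 {1}⟩ : ↥({0, 1} : Finset (Site 1)))
            ⟨1, mem_insert_of_mem (mem_singleton_self 1)⟩)‖ * (Λ'.card * B) := by
  set Φ := heisenbergInteraction n J with hΦ
  have hω : ω ∈ groundStates Φ 1 := hgap.1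
  have hfr : Φ.HasFiniteRange 1 := hasFiniteRange_heisenbergInteraction n J
  set c₀ := ω.expect {0, 1}
    (spinBond n 0 (⟨0, mem_insert_self 0 {1}⟩ : ↥({0, 1} : Finset (Site 1)))
        ⟨1, mem_insert_of_mem (mem_singleton_self 1)⟩ +
      spinBond n 1 (⟨0, mem_insert_self 0 {1}⟩ : ↥({0, 1} : Finset (Site 1)))
        ⟨1, mem_insert_of_mem (mem_singleton_self 1)⟩) with hc₀
  set h₀ : Λ ⊆ Λ' := (subset_thicken Λ 1).trans hT
  set θ' : ↥Λ' → ℝ := fun y => if hy : (y : Site 1) ∈ Λ then θ ⟨y, hy⟩ else 0 with hθ'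
  set H := localHamiltonian (Φ.restrict Λ') univ with hH
  have hUemb : embedOp h₀ (twistOp θ : Op ↥Λ (n + 1)) = twistOp θ' := embedOp_twistOp h₀ θ
  have hUemb' : embedOp h₀ (twistOp (-θ) : Op ↥Λ (n + 1)) = (twistOp θ')ᴴ := by
    rw [embedOp_twistOp h₀, twistOp_conjTranspose]
    congr 1
    funext y
    simp only [hθ', Pi.neg_apply]
    split_ifs <;> simp
  -- gap inequality for `U = U_θ` and ground-state inequality for `Uᴴ = U_{-θ}`
  have h1 := hgap.gap_mul_le_re_expect_unitary hfr (twistOp_conjTranspose_mul_self θ) hT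
  have h2 := hgap.1.re_expect_unitary_nonneg hfr (twistOp_conjTranspose_mul_self (-θ)) hT
  rw [hUemb] at h1
  rw [hUemb', conjTranspose_conjTranspose] at h2
  -- the symmetrised energy is `ω` of the twisted bond sum
  have hsum : ω.expect Λ' ((twistOp θ')ᴴ * H * twistOp θ' - H) +
      ω.expect Λ' (twistOp θ' * H * (twistOp θ')ᴴ - H) =
      (J : ℂ) * (c₀ * ∑ x : ↥Λ', ∑ y : ↥Λ',
        if (y : Site 1) = x + 1 then ((2 * Real.cos (θ' x - θ' y) - 2 : ℝ) : ℂ) else 0) := by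
    rw [← map_add, show (twistOp θ')ᴴ * H * twistOp θ' - H + (twistOp θ' * H * (twistOp θ')ᴴ - H) =
      (twistOp θ')ᴴ * H * twistOp θ' + twistOp θ' * H * (twistOp θ')ᴴ - 2 • H by
        rw [two_nsmul]; abel, hH, hΦ, conj_localHamiltonian_twist, map_smul, map_sum, smul_eq_mul]
    congr 1
    rw [mul_sum]
    refine sum_congr rfl fun x _ => ?_
    rw [map_sum, mul_sum]
    refine sum_congr rfl fun y _ => ?_
    split_ifs with hxy
    · rw [map_smul, hU.expect_spinBond_pair n hω x y hxy, ← hc₀, smul_eq_mul, mul_comm]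
    · rw [map_zero, mul_zero]
  -- take real parts and bound the double sum
  have hre := congrArg Complex.re hsum
  rw [Complex.add_re] at hre
  have hbound : ((J : ℂ) * (c₀ * ∑ x : ↥Λ', ∑ y : ↥Λ',
      if (y : Site 1) = x + 1 then ((2 * Real.cos (θ' x - θ' y) - 2 : ℝ) : ℂ) else 0)).re ≤
      |J| * ‖c₀‖ * (Λ'.card * B) := by
    set s : ℝ := ∑ x : ↥Λ', ∑ y : ↥Λ',
      if (y : Site 1) = x + 1 then (2 * Real.cos (θ' x - θ' y) - 2 : ℝ) else 0 with hs
    have hS : (∑ x : ↥Λ', ∑ y : ↥Λ',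
        if (y : Site 1) = x + 1 then ((2 * Real.cos (θ' x - θ' y) - 2 : ℝ) : ℂ) else 0) = (s : ℂ) := by
      rw [hs]
      push_cast
      refine sum_congr rfl fun x _ => sum_congr rfl fun y _ => ?_
      split_ifs <;> simp
    -- |s| ≤ Σ (2 - 2cos) ≤ #Λ' B
    have hterm : ∀ x y : ↥Λ', |(if (y : Site 1) = x + 1 then
        (2 * Real.cos (θ' x - θ' y) - 2 : ℝ) else 0)| =
        if (y : Site 1) = x + 1 then 2 - 2 * Real.cos (θ' x - θ' y) else 0 := by
      intro x y
      split_ifs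
      · rw [abs_sub_comm, abs_of_nonneg]
        linarith [Real.cos_le_one (θ' x - θ' y)]
      · exact abs_zero
    have hsB : |s| ≤ Λ'.card * B := by
      refine (Finset.abs_sum_le_sum_abs _ _).trans ?_
      refine (sum_le_sum fun x _ => Finset.abs_sum_le_sum_abs _ _).trans ?_
      simp only [hterm]
      exact sum_sum_ite_succ_le hB0 hB
    rw [hS]
    calc ((J : ℂ) * (c₀ * (s : ℂ))).re ≤ ‖(J : ℂ) * (c₀ * (s : ℂ))‖ := Complex.re_le_norm _
      _ = |J| * (‖c₀‖ * |s|) := by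
          rw [norm_mul, norm_mul, Complex.norm_real, Complex.norm_real, Real.norm_eq_abs,
            Real.norm_eq_abs]
      _ ≤ |J| * (‖c₀‖ * (Λ'.card * B)) := by gcongr
      _ = |J| * ‖c₀‖ * (Λ'.card * B) := by ring
  linarith [hre, h1, h2, hbound]

end Literature.MathematicalPhysics.QuantumLattice
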